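import Summits.ABC.StewartYu.PadicW80SizesL
import HarnessLib

/-!
# The archimedean sizes at the `(log p)`-normalised parameter record, I (b): the `SizeHyp` consequences

Support file (theorems only; no named fact), cell `abc-stewartyu` (p1, stub S5): continuation of `PadicW80SizesL.lean`
— twin of the `CW77.Setup.SizeHyp` half of p3's `PadicW80Sizes.lean` on the record `PadicW80ParL`
(`natAbs_bθ_pow_le_pℓ`, `abs_γ_le_pℓ`, `abs_qA_le_pℓ`, `prod_hgt_pow_le_pℓ`, `den_prod_le_pℓ`, `expn_le_of_mem_box_pℓ`,
`abs_qE_le_pℓ`, `abs_qEh_le_pℓ`). Everything is [folklore] book-keeping on [cite: Waldschmidt1980, §3.3–3.4 (pp. 268–270)].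
-/

noncomputable section

open Finset Real
open Literature.NumberTheory.Transcendental
open Literature.NumberTheory.Transcendental.Baker1975
open Literature.NumberTheory.Transcendental.Baker1975.Ch3
open Literature.NumberTheory.Transcendental.CW77

namespace Literature.NumberTheory.Transcendental.CW77

namespace Setup

open Summit.ABC.StewartYu
open Summit.ABC.StewartYu.PadicW80Par (cLp' cTp mRp)

variable {S : Setup} {P : PadicW80ParL S.d} (hy : S.SizeHyp P.V P.Vθ P.W)
include hy

/-! ### Coefficients -/

/-- **`|b_θ|^k ≤ 𝔅`** for `k ≤ T` (`k W ≤ T W⋆ ≤ 𝔘/c_T`). [cite: Waldschmidt1980, §3.3 (p. 268)] -/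
theorem SizeHyp.natAbs_bθ_pow_le_pℓ {k : ℕ} (hk : k ≤ P.Tℓ) : ((S.bθ.natAbs ^ k : ℕ) : ℝ) ≤ P.𝔅ℓ := by
  refine (hy.natAbs_bθ_pow_le_exp k).trans (P.exp_le_𝔅 ?_)
  have hTW := P.TWstar_le; have hW := P.W_le_Wstar; have hT := P.T_pos; have hU := P.𝔘_pos
  have hW1 := P.hW
  have hk' : (k : ℝ) ≤ P.Tℓ := by exact_mod_cast hk
  calc (k : ℝ) * P.W ≤ P.Tℓ * P.Wstarℓ := mul_le_mul hk' hW (by linarith) hT.le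
    _ ≤ P.𝔘ℓ / cTp := hTW
    _ ≤ P.𝔘ℓ / 64 := by unfold cTp; rw [div_le_div_iff₀ (by norm_num) (by norm_num)]; nlinarith

/-! ### The linear-form factor `qA` on the boxes of the `p`-adic ranges -/

/-- `|γⱼ(u)| ≤ 2 U e^W` on the box of level `J`. [cite: Waldschmidt1980, §3.3 (p. 268)] -/
theorem SizeHyp.abs_γ_le_pℓ {J : ℕ} {u : Idx S.d P.hparℓ P.Lbℓ}
    (hu : u ∈ S.box (h := P.hparℓ) (Lb := P.Lbℓ) P.Lℓ P.Lθℓ J) (j : Fin S.d) :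
    |(S.γ u j : ℝ)| ≤ 2 * P.Uℓ * Real.exp P.W := by
  rw [S.mem_box] at hu
  unfold γ
  push_cast
  have h1 : (u.2.1 j : ℝ) ≤ P.Uℓ := by
    have : (u.2.1 j : ℝ) ≤ P.Lℓ j := by exact_mod_cast (hu.1 j).trans (Nat.div_le_self _ _)
    exact this.trans (P.Lp_le_U j)
  have h2 : (u.2.2 : ℝ) ≤ P.Uℓ := by
    have : (u.2.2 : ℝ) ≤ P.Lθℓ := by exact_mod_cast hu.2.trans (Nat.div_le_self _ _)
    exact this.trans P.Lθp_le_U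
  have hW : 1 ≤ Real.exp P.W := Real.one_le_exp (by linarith [P.hW])
  have hU := P.U_pos
  calc |(u.2.1 j : ℝ) + (u.2.2 : ℝ) * (S.β j : ℝ)| ≤ |(u.2.1 j : ℝ)| + |(u.2.2 : ℝ) * (S.β j : ℝ)| :=
        abs_add_le _ _
    _ = (u.2.1 j : ℝ) + (u.2.2 : ℝ) * |(S.β j : ℝ)| := by
        rw [abs_mul, Nat.abs_cast, Nat.abs_cast]
    _ ≤ P.Uℓ + P.Uℓ * Real.exp P.W := add_le_add h1 (mul_le_mul h2 (hy.abs_β_le j) (abs_nonneg _) hU.le)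
    _ ≤ 2 * P.Uℓ * Real.exp P.W := by nlinarith

/-- **`|qA(u, τ')| ≤ 𝔅`** on the box of the `p`-adic ranges, `|τ'| ≤ T`.
[cite: Waldschmidt1980, §3.3 (proof of Lemma 3.3, p. 268)] -/
theorem SizeHyp.abs_qA_le_pℓ {J : ℕ} {u : Idx S.d P.hparℓ P.Lbℓ}
    (hu : u ∈ S.box (h := P.hparℓ) (Lb := P.Lbℓ) P.Lℓ P.Lθℓ J)
    {τ' : Fin S.d → ℕ} (hτ : ∑ j, τ' j ≤ P.Tℓ) : |(S.qA u τ' : ℝ)| ≤ P.𝔅ℓ := by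
  set Γ := 2 * P.Uℓ * Real.exp P.W with hΓ
  have hΓ1 : 1 ≤ Γ := P.one_le_Γ_p
  have h1 : |(S.qA u τ' : ℝ)| ≤ Γ ^ P.Tℓ := by
    unfold qA; push_cast
    rw [abs_prod]
    calc ∏ j, |(S.γ u j : ℝ) ^ τ' j| = ∏ j, |(S.γ u j : ℝ)| ^ τ' j := prod_congr rfl fun j _ => abs_pow _ _
      _ ≤ ∏ j, Γ ^ τ' j := prod_le_prod (fun j _ => by positivity)
          fun j _ => pow_le_pow_left₀ (abs_nonneg _) (hy.abs_γ_le_pℓ hu j) _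
      _ = Γ ^ ∑ j, τ' j := (prod_pow_eq_pow_sum _ _ _)
      _ ≤ Γ ^ P.Tℓ := pow_le_pow_right₀ hΓ1 hτ
  refine h1.trans (P.le_𝔅_of_log_le ?_)
  rw [Real.log_pow]
  have hT := P.T_pos; have hTW := P.TWstar_le; have hTU := P.T_le_𝔘; have hW := P.one_le_Wstar
  calc (P.Tℓ : ℝ) * Real.log Γ ≤ P.Tℓ * (11 * P.Wstarℓ + 1) := mul_le_mul_of_nonneg_left P.log_Γ_le_p hT.le
    _ = 11 * (P.Tℓ * P.Wstarℓ) + P.Tℓ := by ring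
    _ ≤ 11 * (P.𝔘ℓ / cTp) + P.𝔘ℓ / cTp := by gcongr
    _ ≤ P.𝔘ℓ / 64 := by unfold cTp; have := P.𝔘_pos; nlinarith

/-! ### Height factors at the `p`-adic ranges -/

/-- **`∏ H(allᵢ)^{eᵢ} ≤ exp(c 𝔘/(2c_L'))`** when `eᵢ ≤ c Lallᵢ S₀`. [cite: Waldschmidt1980, (3.11) (p. 265)] -/
theorem SizeHyp.prod_hgt_pow_le_pℓ {e : Fin (S.d + 1) → ℕ} {c : ℕ} (he : ∀ i, e i ≤ c * P.Lallℓ i * P.S₀ℓ) :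
    ∏ i, hgt (S.all i) ^ e i ≤ Real.exp (c * (P.𝔘ℓ / (2 * cLp'))) := by
  calc ∏ i, hgt (S.all i) ^ e i ≤ ∏ i, Real.exp (e i * P.Vallℓ i) :=
        prod_le_prod (fun i _ => pow_nonneg (hgt_pos _).le _) fun i _ => hy.hgt_pow_le i (e i)
    _ = Real.exp (∑ i, (e i : ℝ) * P.Vallℓ i) := (Real.exp_sum _ _).symm
    _ ≤ Real.exp (c * (P.𝔘ℓ / (2 * cLp'))) := Real.exp_le_exp.mpr (P.sum_eVp_le he)

/-- **The denominators `∏ den(αⱼ)^{eⱼ} · den θ^{e_θ} ≤ exp(c 𝔘/(2c_L'))`** when `eⱼ ≤ c Lⱼ S₀`,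
`e_θ ≤ c L_θ S₀`. [cite: Waldschmidt1980, (3.11) (p. 265)] -/
theorem SizeHyp.den_prod_le_pℓ {e : Fin S.d → ℕ} {eθ : ℕ} {c : ℕ} (he : ∀ j, e j ≤ c * P.Lℓ j * P.S₀ℓ)
    (heθ : eθ ≤ c * P.Lθℓ * P.S₀ℓ) :
    (((∏ j, (S.α j).den ^ e j) * S.θ.den ^ eθ : ℕ) : ℝ) ≤ Real.exp (c * (P.𝔘ℓ / (2 * cLp'))) := by
  set e' : Fin (S.d + 1) → ℕ := Fin.snoc e eθ with he'
  have hall : (((∏ j, (S.α j).den ^ e j) * S.θ.den ^ eθ : ℕ) : ℝ) = ∏ i, ((S.all i).den : ℝ) ^ e' i := by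
    push_cast
    rw [Fin.prod_univ_castSucc]
    unfold all
    simp only [he', Fin.snoc_castSucc, Fin.snoc_last]
  rw [hall]
  have he'' : ∀ i, e' i ≤ c * P.Lallℓ i * P.S₀ℓ := by
    intro i
    refine Fin.lastCases ?_ (fun j => ?_) i
    · simp only [he', Fin.snoc_last, PadicW80ParL.Lall_last]; exact heθ
    · simp only [he', Fin.snoc_castSucc, PadicW80ParL.Lall_castSucc]; exact he j
  refine le_trans ?_ (hy.prod_hgt_pow_le_pℓ he'')
  refine prod_le_prod (fun i _ => by positivity) fun i _ => ?_
  exact pow_le_pow_left₀ (by positivity) (den_le_hgt _) _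

omit hy in
/-- The exponents on the box of level `J` at a point `s ≤ 2^J · c · S₀` are `≤ c Lallᵢ S₀`. [folklore] -/
theorem expn_le_of_mem_box_pℓ {J c : ℕ} {u : Idx S.d P.hparℓ P.Lbℓ}
    (hu : u ∈ S.box (h := P.hparℓ) (Lb := P.Lbℓ) P.Lℓ P.Lθℓ J) {s : ℕ} (hs : s ≤ 2 ^ J * (c * P.S₀ℓ))
    (i : Fin (S.d + 1)) : S.expn u s i ≤ c * P.Lallℓ i * P.S₀ℓ := by
  rw [S.mem_box] at hu
  have hdiv : ∀ (lam Lq : ℕ), lam ≤ Lq / 2 ^ J → lam * s ≤ c * Lq * P.S₀ℓ := by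
    intro lam Lq hl
    calc lam * s ≤ (Lq / 2 ^ J) * (2 ^ J * (c * P.S₀ℓ)) := Nat.mul_le_mul hl hs
      _ = ((Lq / 2 ^ J) * 2 ^ J) * (c * P.S₀ℓ) := by ring
      _ ≤ Lq * (c * P.S₀ℓ) := Nat.mul_le_mul_right _ (Nat.div_mul_le_self Lq (2 ^ J))
      _ = c * Lq * P.S₀ℓ := by ring
  refine Fin.lastCases ?_ (fun j => ?_) i
  · rw [S.expn_last, PadicW80ParL.Lall_last]; exact hdiv _ _ hu.2
  · rw [S.expn_castSucc, PadicW80ParL.Lall_castSucc]; exact hdiv _ _ (hu.1 j)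

/-- **`|qE(u, s)| ≤ exp(c 𝔘/(2c_L'))`** on the box of level `J`, `s ≤ 2^J c S₀`.
[cite: Waldschmidt1980, §3.4 (3.21) (p. 269)] -/
theorem SizeHyp.abs_qE_le_pℓ {J c : ℕ} {u : Idx S.d P.hparℓ P.Lbℓ}
    (hu : u ∈ S.box (h := P.hparℓ) (Lb := P.Lbℓ) P.Lℓ P.Lθℓ J)
    {s : ℕ} (hs : s ≤ 2 ^ J * (c * P.S₀ℓ)) : |(S.qE u s : ℝ)| ≤ Real.exp (c * (P.𝔘ℓ / (2 * cLp'))) := by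
  have he := S.expn_le_of_mem_box_pℓ (P := P) hu hs
  unfold qE; push_cast
  rw [abs_of_nonneg (by
    refine mul_nonneg (prod_nonneg fun j _ => pow_nonneg ?_ _) (pow_nonneg ?_ _)
    · exact_mod_cast (S.α_pos j).le
    · exact_mod_cast S.θ_pos.le)]
  have hall : (∏ j, (S.α j : ℝ) ^ (u.2.1 j * s)) * (S.θ : ℝ) ^ (u.2.2 * s) =
      ∏ i, ((S.all i : ℚ) : ℝ) ^ S.expn u s i := by
    rw [Fin.prod_univ_castSucc]
    unfold all
    simp only [S.expn_castSucc, S.expn_last, Fin.snoc_castSucc, Fin.snoc_last]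
  rw [hall]
  have key := hy.prod_hgt_pow_le_pℓ he
  refine le_trans ?_ key
  refine prod_le_prod (fun i _ => pow_nonneg (by exact_mod_cast (S.all_pos i).le) _) fun i _ => ?_
  exact pow_le_pow_left₀ (by exact_mod_cast (S.all_pos i).le) (self_le_hgt _) _

/-- **`|qEh(u, s)| ≤ exp(c 𝔘/(2c_L'))`** on the box of level `J`, `s ≤ 2^J c S₀` (the half-point
factor). [cite: Waldschmidt1980, §3.4 (3.22) (p. 270)] -/
theorem SizeHyp.abs_qEh_le_pℓ {J c : ℕ} {u : Idx S.d P.hparℓ P.Lbℓ}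
    (hu : u ∈ S.box (h := P.hparℓ) (Lb := P.Lbℓ) P.Lℓ P.Lθℓ J)
    {s : ℕ} (hs : s ≤ 2 ^ J * (c * P.S₀ℓ)) : |(S.qEh u s : ℝ)| ≤ Real.exp (c * (P.𝔘ℓ / (2 * cLp'))) := by
  have he := S.expn_le_of_mem_box_pℓ (P := P) hu hs
  unfold qEh; push_cast
  rw [abs_of_nonneg (prod_nonneg fun i _ => pow_nonneg (by exact_mod_cast (S.all_pos i).le) _)]
  have he'' : ∀ i, S.expn u s i / 2 ≤ c * P.Lallℓ i * P.S₀ℓ := fun i => (Nat.div_le_self _ _).trans (he i)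
  have := hy.prod_hgt_pow_le_pℓ he''
  refine le_trans ?_ this
  refine prod_le_prod (fun i _ => pow_nonneg (by exact_mod_cast (S.all_pos i).le) _) fun i _ => ?_
  exact pow_le_pow_left₀ (by exact_mod_cast (S.all_pos i).le) (self_le_hgt _) _

end Setup

end Literature.NumberTheory.Transcendental.CW77

end
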